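import Mathlib
import HarnessLib

/-!
# The kernel of the differential of a defining submersion is intrinsic (real `C¹` version)

Helper for the crux `SuperThresholdRigidity` of route `HolomorphicityRate`
(item stmt-HodgeConjecture-2737, skeleton line `registered`, stub `stub_kerLeOfEqOnZeroSet`):
in finite-dimensional real normed spaces, if `φ : E → F` is `C¹` at `a` with `dφ(a)` onto and
`ψ : E → G` is differentiable at `a` and constant on the fibre `{φ = φ a}` near `a`, then
`ker dφ(a) ≤ ker dψ(a)`. Real analogue of the tree's holomorphic
`Literature.Geometry.Kaehler.SCV.ker_fderiv_le_ker_fderiv_of_forall_eq`, proved with Mathlib's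
finite-dimensional implicit function theorem (`HasStrictFDerivAt.implicitFunction`).

## References

* E. M. Chirka, *Complex Analytic Sets*, Kluwer (1989), A2.2 [Chirka1989].
* J. M. Lee, *Introduction to Smooth Manifolds*, 2nd ed., GTM 218 (2013), Thm. C.40
  [LeeSmoothManifolds2013].
-/

-- `Summit.HodgeConjecture.HodgeConjecture.Theorems` is the mandated namespace (single-problem summit:
-- Problem = Summit), which `linter.dupNamespace` flags; restated here so stand-alone elaboration is
-- warning-free too.
set_option linter.dupNamespace false

open Filter Topology

namespace Summit.HodgeConjecture.HodgeConjecture.Theorems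

/-- **The kernel of the differential of a defining submersion is intrinsic (real `C¹` version).**
In finite-dimensional real normed spaces: if `φ : E → F` is `C¹` at `a` with `dφ(a)` onto,
`ψ : E → G` is differentiable at `a`, and `ψ` is constant on the fibre `{φ = φ a}` near `a`, then
`ker dφ(a) ≤ ker dψ(a)`, i.e. `dφ(a) v = 0 → dψ(a) v = 0`. Proof: by the implicit function
theorem the fibre contains the image of the map `σ k = implicitFunction (φ a) k` from `ker dφ(a)`,
which is strictly differentiable at `0` with differential the inclusion and `σ 0 = a`; so `ψ ∘ σ`
is constant near `0`, and the chain rule gives `dψ(a) ∘ incl = 0`.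
[Chirka1989, A2.2; LeeSmoothManifolds2013, Thm. C.40] [folklore] -/
theorem stub_kerLeOfEqOnZeroSet : ∀ {E F G : Type*} [NormedAddCommGroup E] [NormedSpace ℝ E]
    [FiniteDimensional ℝ E] [NormedAddCommGroup F] [NormedSpace ℝ F] [FiniteDimensional ℝ F]
    [NormedAddCommGroup G] [NormedSpace ℝ G] {φ : E → F} {ψ : E → G} {a : E},
    ContDiffAt ℝ 1 φ a → DifferentiableAt ℝ ψ a → Function.Surjective (fderiv ℝ φ a) →
    (∀ᶠ z in nhds a, φ z = φ a → ψ z = ψ a) →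
    ∀ v : E, fderiv ℝ φ a v = 0 → fderiv ℝ ψ a v = 0 := by
  intro E F G _ _ _ _ _ _ _ _ φ ψ a hφ hψ hsurj hfib v hv
  haveI : CompleteSpace E := FiniteDimensional.complete ℝ E
  have hφ' : HasStrictFDerivAt φ (fderiv ℝ φ a) a := hφ.hasStrictFDerivAt one_ne_zero
  have hrange : (fderiv ℝ φ a).range = ⊤ := LinearMap.range_eq_top.2 hsurj
  -- the implicit-function parametrisation of the fibre `{φ = φ a}` by `ker dφ(a)` near `0`
  set σ : (fderiv ℝ φ a).ker → E := hφ'.implicitFunction φ (fderiv ℝ φ a) hrange (φ a) with hσ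
  have hσ0 : σ 0 = a := hφ'.implicitFunction_apply_image hrange
  have hσd : HasStrictFDerivAt σ (fderiv ℝ φ a).ker.subtypeL 0 := hφ'.to_implicitFunction hrange
  have hσt : Tendsto σ (𝓝 0) (𝓝 a) :=
    hφ'.tendsto_implicitFunction hrange tendsto_const_nhds tendsto_id
  have hφσ : ∀ᶠ k in 𝓝 (0 : (fderiv ℝ φ a).ker), φ (σ k) = φ a := by
    have hT : Tendsto (fun k : (fderiv ℝ φ a).ker => (φ a, k)) (𝓝 0) (𝓝 (φ a, 0)) :=
      tendsto_const_nhds.prodMk_nhds tendsto_id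
    filter_upwards [hT.eventually (hφ'.map_implicitFunction_eq hrange)] with k hk
    exact hk
  -- `ψ ∘ σ` is constant near `0`
  have hψσ : (fun k => ψ (σ k)) =ᶠ[𝓝 (0 : (fderiv ℝ φ a).ker)] fun _ => ψ a := by
    filter_upwards [hφσ, hσt.eventually hfib] with k hk hk'
    exact hk' hk
  -- chain rule at `0` versus the zero derivative of the constant
  have hψa : HasFDerivAt ψ (fderiv ℝ ψ a) (σ 0) := by
    rw [hσ0]
    exact hψ.hasFDerivAt
  have hcomp : HasFDerivAt (fun k => ψ (σ k)) ((fderiv ℝ ψ a).comp (fderiv ℝ φ a).ker.subtypeL) 0 :=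
    hψa.comp 0 hσd.hasFDerivAt
  have hzero := hcomp.unique ((hasFDerivAt_const (ψ a) 0).congr_of_eventuallyEq hψσ)
  have hvK : v ∈ (fderiv ℝ φ a).ker := LinearMap.mem_ker.2 hv
  have key := congrArg (fun L => L ⟨v, hvK⟩) hzero
  simpa using key

end Summit.HodgeConjecture.HodgeConjecture.Theorems
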